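import Summits.QuantumFields.BalabanUV.T4Continuum.Support.VariationalVectorGaugeSliceDist
import Summits.QuantumFields.BalabanUV.T4Continuum.Support.VariationalCovariantOneStepPhys

/-!
# T⁴ programme, spine node NE2 (U1a), lane P2 — THE (ONE-min) SOCKET TRANSFERS BETWEEN TWO GAUGE FIXINGS AND TWO ONE-STEP CARRIER FAMILIES
# (item «ONE-MIN AT TAXI DATA — THE COMPOSITE-FIBRE ↔ TAXI-FRAME BRIDGE», file 3; ABSTRACT bookkeeping, model level; cell `pub-balaban`)

NE2 formalisation swarm `b2b-balaban-t4-ne2-formalise-*`, leaf prover 04 GEN 7 (`prover-b2b-balaban-t4-ne2-formalise-leaf-04-g7-0`); register row «P2-sup» of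
`t4/formal/NE2/LEAVES.md`; journal CLAIMS.log INTENT 2026-08-20 l.21025.  On top of leaf-01-g8's `VariationalVectorGaugeSliceDist.{SfV_eq_zero_add, sqrt_SfV_add_le,
sq_sqrt_add_add_le}` (p229806), `VariationalCovariantOneStepPhys.scale_sq_sqrt_add` and `VariationalVectorForm.{ScV, SfV, qWV, SfV_nonneg}` — BY NAME; functionals, averages and competitors are LETTERS, as in
leaf-01-g8's `VariationalVectorOneMinCentred.hONEm_of_pieces`.

WHY.  The vector END (`VariationalVectorEndMonotone.effV_tendsto_of_upper(_geom)`, instantiated at Bałaban's taxi data in this lineage's parts 6–8) consumes at every level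
the (ONE-min) socket `hONEm`: at a coarse minimiser `W₀` of `ScV R G` in the fibre `Q_k W₀ = φ`, a fine competitor `g` with `Q_k(Q₂ g) = φ` and
`SfV R′ G₂′ g ≤ (√(S W₀ + ε·ρ W₀) + δ′√(qWV W₀))²`, in the END's letters (`Q₂` = the one-step carriers of the tower, `G₂′` = the pullback of the next level's functional).
The supplier of record (leaf-01-g8∕g9 `hONEm_centred(_reg)`) delivers the same SHAPE in ITS letters (`Q₁` = frame-adapted carriers, `G₁′` = the composite-fibre
functional).  This file moves the shape from (`Q₁`, `G₁′`) to (`Q₂`, `G₂′`) given exactly three comparison data — a KERNEL SWAP `c_f·G₂′ ≤ (1+u)·c_f·G₁′ + v·(SfV R′ G₂′ +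
nsqV(Q_k Q₂ ·))` (at taxi data: file 2's `projG_taxi_le_comp` + the fine (Går)), a CARRIER DEFECT `nsqV (Q_k(Q₁ g) − Q_k(Q₂ g)) ≤ γ·(SfV R′ G₂′ g + nsqV(Q_k(Q₂ g)))`
(at taxi data: `‖lineT − frameT‖ ≤ γ_k` + Jensen + fine V-P), and the fine V-UB leaf for (`Q₂`, `G₂′`) — and NOTHING about how the supplier proved its shape.

THE STATEMENTS ([folklore]; pure bookkeeping over an arbitrary normed `E`):
 * §1 `nsqV_sub_le'` (`nsqV(a − b) ≤ 2nsqV a + 2nsqV b`), `le_of_le_add_mul_self` (`F ≤ P + xF`, `x ≤ ½` ⟹ `F ≤ (1+2x)P`), `sq_sqrt_add_sqrt_le` (Young under the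
   square), `collect_le` ∕ `shape_le` (the pure arithmetic of §3; `VariationalCovariantOneStepPhys.scale_sq_sqrt_add` BY NAME).
 * §2 **`fine_transfer`** (one field): from `Q_k(Q₁ g) = φ`, `F₁ := SfV R′ G₁′ g`, the kernel swap (`0 ≤ u`, `0 ≤ v ≤ ⅛`) and the carrier defect (`0 ≤ γ ≤ ¼`):
   `F₂ := SfV R′ G₂′ g ≤ (1+4v)((1+u)F₁ + 4v·nsqV φ)` and `N₂ := nsqV(Q_k(Q₂ g)) ≤ 4·nsqV φ + 4γ·F₂`.
 * §3 **`hONEm_transfer`**: the END's `hONEm` SHAPE for (`Q₁`, `G₁′`) with (`ε`, `δ′`, `ρ := S + nsqV φ`) ⟹ the same SHAPE for (`Q₂`, `G₂′`) with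
   `ε₂ := (A − 1) + A·ε + B`, `δ′₂ := √A·δ′`, where `A := (1 + w + (1+w⁻¹)Λγ(1+4γ))·(1+4v)(1+u)`, `B := 4v(1+4v)·(1 + w + (1+w⁻¹)Λγ(1+4γ)) + 4(1+w⁻¹)Λγ` (any `w > 0`;
   `Λ` the fine V-UB constant for (`Q₂`, `G₂′`)) — every summand of `ε₂ − ε` carries `u`, `v`, `γ` or `w`, so a geometric choice `u_k, v_k, γ_k, w_k → 0` keeps the
   END's summability.
NOT HERE: any lattice object; the three comparison data at taxi data (files 1, 2, 4 of the item).

HONEST FRAMING (T4-DAG p. 1).  Rung (B)+1 only — NOT infinite volume, NOT a mass gap, NOT Clay.  NE2 NOT IN PRINT, NOT proved here.  MODEL LEVEL (c5): every functional,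
average and constant is a LETTER; elementary real arithmetic ([folklore]); nothing printed is a hypothesis; no `def`, no `def … : Prop`, no `sorry`; axioms standard.
V-END with background ∕ NE2 NOT proved; NE3 OPEN; spine PROVED 0∕9 unchanged.  HONEST DEPENDENCY (cell, verbatim): continuum YM on T⁴ ⇐ BetaPertH ∧ nine spine
estimates (0/9 proved); BetaPertH ⇐ (D1) ∧ (D4) ∧ CAP+tail; G-an2-4 gates asym, D1 and NE2/3/4.
-/

noncomputable section

namespace Summit.QuantumFields.BalabanUV.T4Continuum.OneMinTransfer

open Finset
open Literature.MathematicalPhysics.QuantumFieldTheory.Balaban1983to89.B5Prop11Plancherel (Tor fine)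
open Summit.QuantumFields.BalabanUV.T4Continuum.VariationalVectorForm (curlSq ScV SfV qWV curlSq_nonneg SfV_nonneg ScV_nonneg qWV_nonneg)
open Summit.QuantumFields.BalabanUV.T4Continuum.VectorBlockTrialForm (nsqV nsqV_nonneg)
open Summit.QuantumFields.BalabanUV.T4Continuum.VariationalVectorGaugeSliceDist (SfV_eq_zero_add sqrt_SfV_add_le sq_sqrt_add_add_le)
open Summit.QuantumFields.BalabanUV.T4Continuum.VariationalCovariantOneStepPhys (scale_sq_sqrt_add)

variable {d : ℕ} {E : Type*} [NormedAddCommGroup E] [NormedSpace ℂ E]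
variable (n L : ℕ) [NeZero n] [NeZero L] (M : Fin d → ℕ) [hM : ∀ μ, NeZero (M μ)]

/-! ## §1 Pieces of real arithmetic -/

section Arith

omit [NormedSpace ℂ E] [NeZero n] [NeZero L] in
/-- `nsqV (a − b) ≤ 2·nsqV a + 2·nsqV b`. [folklore] -/
theorem nsqV_sub_le' (a b : Tor M → Fin d → E) : nsqV M (a - b) ≤ 2 * nsqV M a + 2 * nsqV M b := by
  unfold nsqV
  rw [mul_sum, mul_sum, ← sum_add_distrib]
  refine sum_le_sum fun y _ => ?_
  rw [mul_sum, mul_sum, ← sum_add_distrib]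
  refine sum_le_sum fun μ _ => ?_
  have h1 : ‖(a - b) y μ‖ ^ 2 ≤ (‖a y μ‖ + ‖b y μ‖) ^ 2 := pow_le_pow_left₀ (norm_nonneg _) (norm_sub_le _ _) 2
  nlinarith [h1, sq_nonneg (‖a y μ‖ - ‖b y μ‖)]

omit [NeZero n] [NeZero L] hM in
/-- absorbing a small multiple of the left side: `F ≤ P + x·F`, `0 ≤ x ≤ ½`, `0 ≤ P` ⟹ `F ≤ (1 + 2x)·P`. [folklore] -/
theorem le_of_le_add_mul_self {F P x : ℝ} (hP : 0 ≤ P) (hx0 : 0 ≤ x) (hx : x ≤ 1 / 2) (h : F ≤ P + x * F) : F ≤ (1 + 2 * x) * P := by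
  nlinarith [h, hP, hx0, hx, mul_nonneg hx0 hP]

omit [NeZero n] [NeZero L] hM in
/-- Young under the square: `(√a + √b)² ≤ (1+w)·a + (1+w⁻¹)·b` (`0 ≤ a, b`, `0 < w`). [folklore] -/
theorem sq_sqrt_add_sqrt_le {a b w : ℝ} (ha : 0 ≤ a) (hb : 0 ≤ b) (hw : 0 < w) :
    (Real.sqrt a + Real.sqrt b) ^ 2 ≤ (1 + w) * a + (1 + w⁻¹) * b := by
  have hwi : 0 ≤ w⁻¹ := inv_nonneg.mpr hw.le
  have h := sq_nonneg (Real.sqrt w * Real.sqrt a - Real.sqrt w⁻¹ * Real.sqrt b)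
  have hsw : Real.sqrt w ^ 2 = w := Real.sq_sqrt hw.le
  have hsw' : Real.sqrt w⁻¹ ^ 2 = w⁻¹ := Real.sq_sqrt hwi
  have hprod : Real.sqrt w * Real.sqrt w⁻¹ = 1 := by rw [← Real.sqrt_mul hw.le, mul_inv_cancel₀ hw.ne', Real.sqrt_one]
  have e1 : Real.sqrt a ^ 2 = a := Real.sq_sqrt ha
  have e2 : Real.sqrt b ^ 2 = b := Real.sq_sqrt hb
  nlinarith [h, hsw, hsw', hprod, e1, e2, Real.sqrt_nonneg a, Real.sqrt_nonneg b]

omit [NeZero n] [NeZero L] hM in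
/-- **COLLECTING THE THREE COMPARISONS** (pure arithmetic): `N₂ ≤ 4Z + 4γF₂`, `F₂ ≤ (1+4v)((1+u)F₁ + 4vZ)`, `T ≤ (1+w)F₂ + (1+w⁻¹)Λγ(F₂ + N₂)`, `F₁ ≤ X` ⟹
`T ≤ A·X + B·Z` with `A = C(1+4v)(1+u)`, `B = C(1+4v)(4v) + 4(1+w⁻¹)Λγ`, `C = 1 + w + (1+w⁻¹)Λγ(1+4γ)`. [folklore] -/
theorem collect_le {F₁ F₂ N₂ T Z X u v γ w Λ : ℝ} (hu : 0 ≤ u) (hv : 0 ≤ v) (hγ : 0 ≤ γ) (hw : 0 < w)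
    (hΛ : 0 ≤ Λ) (hN : N₂ ≤ 4 * Z + 4 * γ * F₂) (hF₂ : F₂ ≤ (1 + 4 * v) * ((1 + u) * F₁ + 4 * v * Z))
    (hT : T ≤ (1 + w) * F₂ + (1 + w⁻¹) * (Λ * γ * (F₂ + N₂))) (hX : F₁ ≤ X) :
    T ≤ ((1 + w + (1 + w⁻¹) * (Λ * γ) * (1 + 4 * γ)) * (1 + 4 * v) * (1 + u)) * X
      + ((1 + w + (1 + w⁻¹) * (Λ * γ) * (1 + 4 * γ)) * (1 + 4 * v) * (4 * v) + 4 * ((1 + w⁻¹) * (Λ * γ))) * Z := by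
  have hwi : 0 ≤ w⁻¹ := inv_nonneg.mpr hw.le
  have hΛγ : 0 ≤ (1 + w⁻¹) * (Λ * γ) := by positivity
  have hC0 : 0 ≤ 1 + w + (1 + w⁻¹) * (Λ * γ) * (1 + 4 * γ) := by positivity
  -- step 1: `T ≤ C·F₂ + 4(1+w⁻¹)Λγ·Z`
  have s1 : T ≤ (1 + w + (1 + w⁻¹) * (Λ * γ) * (1 + 4 * γ)) * F₂ + 4 * ((1 + w⁻¹) * (Λ * γ)) * Z := by
    have h := mul_le_mul_of_nonneg_left hN hΛγ
    have e : (1 + w) * F₂ + (1 + w⁻¹) * (Λ * γ * (F₂ + N₂)) = (1 + w) * F₂ + (1 + w⁻¹) * (Λ * γ) * F₂ + (1 + w⁻¹) * (Λ * γ) * N₂ := by ring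
    have e2 : (1 + w⁻¹) * (Λ * γ) * (4 * Z + 4 * γ * F₂) = 4 * ((1 + w⁻¹) * (Λ * γ)) * Z + (1 + w⁻¹) * (Λ * γ) * (4 * γ) * F₂ := by ring
    have e3 : (1 + w + (1 + w⁻¹) * (Λ * γ) * (1 + 4 * γ)) * F₂ = (1 + w) * F₂ + (1 + w⁻¹) * (Λ * γ) * F₂ + (1 + w⁻¹) * (Λ * γ) * (4 * γ) * F₂ := by ring
    linarith [hT, h, e, e2, e3]
  -- step 2: `C·F₂ ≤ C(1+4v)((1+u)F₁ + 4vZ)` and `F₁ ≤ X`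
  have s2 := mul_le_mul_of_nonneg_left hF₂ hC0
  have s3 : (1 + w + (1 + w⁻¹) * (Λ * γ) * (1 + 4 * γ)) * ((1 + 4 * v) * ((1 + u) * F₁ + 4 * v * Z))
      ≤ (1 + w + (1 + w⁻¹) * (Λ * γ) * (1 + 4 * γ)) * ((1 + 4 * v) * ((1 + u) * X + 4 * v * Z)) := by
    have h1 : (1 + u) * F₁ ≤ (1 + u) * X := mul_le_mul_of_nonneg_left hX (by linarith)
    have h2 : (1 + 4 * v) * ((1 + u) * F₁ + 4 * v * Z) ≤ (1 + 4 * v) * ((1 + u) * X + 4 * v * Z) :=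
      mul_le_mul_of_nonneg_left (by linarith) (by positivity)
    exact mul_le_mul_of_nonneg_left h2 hC0
  have e : (1 + w + (1 + w⁻¹) * (Λ * γ) * (1 + 4 * γ)) * ((1 + 4 * v) * ((1 + u) * X + 4 * v * Z)) + 4 * ((1 + w⁻¹) * (Λ * γ)) * Z
      = ((1 + w + (1 + w⁻¹) * (Λ * γ) * (1 + 4 * γ)) * (1 + 4 * v) * (1 + u)) * X
        + ((1 + w + (1 + w⁻¹) * (Λ * γ) * (1 + 4 * γ)) * (1 + 4 * v) * (4 * v) + 4 * ((1 + w⁻¹) * (Λ * γ))) * Z := by ring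
  linarith [s1, s2, s3, e]

omit [NeZero n] [NeZero L] hM in
/-- **BACK INTO THE END's SHAPE** (pure arithmetic): for `1 ≤ A`, `0 ≤ B`,
`A·(√(S + ε(S+Z)) + δ′√q)² + B·Z ≤ (√(S + ((A−1) + Aε + B)(S+Z)) + (√A·δ′)√q)²`. [folklore] -/
theorem shape_le {S Z q ε δ' A B : ℝ} (hS : 0 ≤ S) (hZ : 0 ≤ Z) (hε : 0 ≤ ε) (hδ' : 0 ≤ δ') (hA1 : 1 ≤ A) (hB : 0 ≤ B) :
    A * (Real.sqrt (S + ε * (S + Z)) + δ' * Real.sqrt q) ^ 2 + B * Z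
      ≤ (Real.sqrt (S + ((A - 1) + A * ε + B) * (S + Z)) + (Real.sqrt A * δ') * Real.sqrt q) ^ 2 := by
  have hA0 : 0 ≤ A := by linarith
  have hin0 : 0 ≤ S + ε * (S + Z) := by positivity
  rw [scale_sq_sqrt_add hA0, show Real.sqrt A * (δ' * Real.sqrt q) = (Real.sqrt A * δ') * Real.sqrt q by ring]
  have h2 := sq_sqrt_add_add_le (a := A * (S + ε * (S + Z))) (b := B * Z) (c := (Real.sqrt A * δ') * Real.sqrt q)
    (by positivity) (by positivity) (by positivity)
  refine h2.trans (pow_le_pow_left₀ (by positivity) (add_le_add (Real.sqrt_le_sqrt ?_) le_rfl) 2)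
  nlinarith [hS, hZ, hA1, hB, hε]

end Arith

/-! ## §2 One field: the fine form and the fine average after the kernel swap -/

section Fine

variable {R' : Tor (fine L (fine n M)) → Fin d → (E →L[ℂ] E)}
variable {G₁' G₂' : (Tor (fine L (fine n M)) → Fin d → E) → ℝ}
variable {Qk : (Tor (fine n M) → Fin d → E) → (Tor M → Fin d → E)} {Q₁ Q₂ : (Tor (fine L (fine n M)) → Fin d → E) → (Tor (fine n M) → Fin d → E)}

/-- **THE KERNEL SWAP ON ONE FIELD**: `0 ≤ G₁′, G₂′`, `Q_k(Q₁ g) = φ`, kernel swap `c_f G₂′ g ≤ (1+u)c_f G₁′ g + v(SfV R′ G₂′ g + nsqV(Q_k(Q₂ g)))` (`0 ≤ u`, `0 ≤ v ≤ ⅛`),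
carrier defect `nsqV(Q_k(Q₁ g) − Q_k(Q₂ g)) ≤ γ(SfV R′ G₂′ g + nsqV(Q_k(Q₂ g)))` (`0 ≤ γ ≤ ¼`) ⟹
`nsqV(Q_k(Q₂ g)) ≤ 4·nsqV φ + 4γ·SfV R′ G₂′ g` and `SfV R′ G₂′ g ≤ (1+4v)·((1+u)·SfV R′ G₁′ g + 4v·nsqV φ)`. [folklore] -/
theorem fine_transfer (hG0₁ : ∀ V, 0 ≤ G₁' V) (hG0₂ : ∀ V, 0 ≤ G₂' V) {u v γ : ℝ} (hu : 0 ≤ u) (hv0 : 0 ≤ v) (hv : v ≤ 1 / 8) (hγ0 : 0 ≤ γ) (hγ : γ ≤ 1 / 4)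
    {g : Tor (fine L (fine n M)) → Fin d → E} {φ : Tor M → Fin d → E} (hg : Qk (Q₁ g) = φ)
    (hG12 : (((n : ℝ) * L) ^ d)⁻¹ * (((n : ℝ) * L) ^ 2 * G₂' g)
      ≤ (1 + u) * ((((n : ℝ) * L) ^ d)⁻¹ * (((n : ℝ) * L) ^ 2 * G₁' g)) + v * (SfV n L M R' G₂' g + nsqV M (Qk (Q₂ g))))
    (hQ12 : nsqV M (Qk (Q₁ g) - Qk (Q₂ g)) ≤ γ * (SfV n L M R' G₂' g + nsqV M (Qk (Q₂ g)))) :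
    nsqV M (Qk (Q₂ g)) ≤ 4 * nsqV M φ + 4 * γ * SfV n L M R' G₂' g ∧
      SfV n L M R' G₂' g ≤ (1 + 4 * v) * ((1 + u) * SfV n L M R' G₁' g + 4 * v * nsqV M φ) := by
  have hF₁0 : 0 ≤ SfV n L M R' G₁' g := SfV_nonneg n L M R' hG0₁ g
  have hF₂0 : 0 ≤ SfV n L M R' G₂' g := SfV_nonneg n L M R' hG0₂ g
  have hN₂0 : 0 ≤ nsqV M (Qk (Q₂ g)) := nsqV_nonneg M _
  have hZ0 : 0 ≤ nsqV M φ := nsqV_nonneg M _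
  -- the fine average: `Q_k(Q₂ g) = φ − (Q_k(Q₁ g) − Q_k(Q₂ g))`
  have hN : nsqV M (Qk (Q₂ g)) ≤ 4 * nsqV M φ + 4 * γ * SfV n L M R' G₂' g := by
    have e : φ - (Qk (Q₁ g) - Qk (Q₂ g)) = Qk (Q₂ g) := by rw [← hg]; abel
    have h1 := nsqV_sub_le' M φ (Qk (Q₁ g) - Qk (Q₂ g))
    rw [e] at h1
    have h2 : nsqV M (Qk (Q₂ g)) ≤ (2 * nsqV M φ + 2 * γ * SfV n L M R' G₂' g) + (2 * γ) * nsqV M (Qk (Q₂ g)) := by nlinarith [h1, hQ12]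
    have h3 := le_of_le_add_mul_self (by positivity) (by positivity) (by linarith) h2
    nlinarith [h3, hγ, hγ0, hZ0, hF₂0, mul_nonneg hγ0 hF₂0]
  refine ⟨hN, ?_⟩
  -- the fine form: `SfV R′ G₂′ = SfV R′ 0 + c_f G₂′ ≤ (1+u)(SfV R′ 0 + c_f G₁′) + v(F₂ + N₂)`
  have hS0 : 0 ≤ SfV n L M R' (fun _ => 0) g := SfV_nonneg n L M R' (fun _ => le_rfl) g
  have eF₂ := SfV_eq_zero_add n L M R' G₂' g
  have eF₁ := SfV_eq_zero_add n L M R' G₁' g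
  have h1 : SfV n L M R' G₂' g ≤ (1 + u) * SfV n L M R' G₁' g + v * (SfV n L M R' G₂' g + nsqV M (Qk (Q₂ g))) := by
    have := mul_nonneg hu hS0
    have h' : (1 + u) * SfV n L M R' G₁' g
        = (1 + u) * SfV n L M R' (fun _ => 0) g + (1 + u) * ((((n : ℝ) * L) ^ d)⁻¹ * (((n : ℝ) * L) ^ 2 * G₁' g)) := by rw [eF₁]; ring
    linarith [eF₂, hG12, this, h']
  have h2 : SfV n L M R' G₂' g ≤ ((1 + u) * SfV n L M R' G₁' g + 4 * v * nsqV M φ) + (v + 4 * v * γ) * SfV n L M R' G₂' g := by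
    have := mul_le_mul_of_nonneg_left hN hv0
    linarith [h1, this]
  have hx : v + 4 * v * γ ≤ 1 / 2 := by nlinarith
  have h3 := le_of_le_add_mul_self (by positivity) (by positivity) hx h2
  have h4 : 1 + 2 * (v + 4 * v * γ) ≤ 1 + 4 * v := by nlinarith
  exact h3.trans (mul_le_mul_of_nonneg_right h4 (by positivity))

end Fine

/-! ## §3 The socket transfer -/

section Socket

variable {R : Tor (fine n M) → Fin d → (E →L[ℂ] E)} {R' : Tor (fine L (fine n M)) → Fin d → (E →L[ℂ] E)}
variable {G : (Tor (fine n M) → Fin d → E) → ℝ} {G₁' G₂' : (Tor (fine L (fine n M)) → Fin d → E) → ℝ}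
variable {Qk : (Tor (fine n M) → Fin d → E) → (Tor M → Fin d → E)} {Q₁ Q₂ : (Tor (fine L (fine n M)) → Fin d → E) → (Tor (fine n M) → Fin d → E)}

/-- **THE (ONE-min) SOCKET TRANSFERS** from (`Q₁`, `G₁′`) to (`Q₂`, `G₂′`).  Data: `0 ≤ G, G₁′, G₂′`, `√G₂′` subadditive, `Q_k ∘ Q₂` additive; the SUPPLIER's shape
`hONE₁` with constants `0 ≤ ε`, `0 ≤ δ′` and `ρ := S + nsqV φ` (`S := ScV R G`); the kernel swap `hG12` (`0 ≤ u`, `0 ≤ v ≤ ⅛`), the carrier defect `hQ12`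
(`0 ≤ γ ≤ ¼`), the fine V-UB `hUBf₂` (`0 ≤ Λ`) for (`Q₂`, `G₂′`); a free `w > 0`.  Conclusion: the END's `hONEm` shape for (`Q₂`, `G₂′`) with
`ε₂ = (A − 1) + A·ε + B`, `δ′₂ = √A·δ′`, `A = (1 + w + (1+w⁻¹)Λγ(1+4γ))(1+4v)(1+u)`, `B = (1 + w + (1+w⁻¹)Λγ(1+4γ))(1+4v)(4v) + 4(1+w⁻¹)Λγ`. [folklore] -/
theorem hONEm_transfer (hG0 : ∀ W, 0 ≤ G W) (hG0₁ : ∀ V, 0 ≤ G₁' V) (hG0₂ : ∀ V, 0 ≤ G₂' V)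
    (hGadd₂ : ∀ A B, Real.sqrt (G₂' (A + B)) ≤ Real.sqrt (G₂' A) + Real.sqrt (G₂' B))
    (hQadd₂ : ∀ A B, Qk (Q₂ (A + B)) = Qk (Q₂ A) + Qk (Q₂ B))
    {ε δ' : ℝ} (hε : 0 ≤ ε) (hδ' : 0 ≤ δ')
    (hONE₁ : ∀ (φ : Tor M → Fin d → E) (W₀ : Tor (fine n M) → Fin d → E), Qk W₀ = φ → (∀ W, Qk W = φ → ScV n M R G W₀ ≤ ScV n M R G W) →
      ∃ g, Qk (Q₁ g) = φ ∧ SfV n L M R' G₁' g ≤ (Real.sqrt (ScV n M R G W₀ + ε * (ScV n M R G W₀ + nsqV M φ)) + δ' * Real.sqrt (qWV n M W₀)) ^ 2)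
    {u v γ : ℝ} (hu : 0 ≤ u) (hv0 : 0 ≤ v) (hv : v ≤ 1 / 8) (hγ0 : 0 ≤ γ) (hγ : γ ≤ 1 / 4)
    (hG12 : ∀ g, (((n : ℝ) * L) ^ d)⁻¹ * (((n : ℝ) * L) ^ 2 * G₂' g)
      ≤ (1 + u) * ((((n : ℝ) * L) ^ d)⁻¹ * (((n : ℝ) * L) ^ 2 * G₁' g)) + v * (SfV n L M R' G₂' g + nsqV M (Qk (Q₂ g))))
    (hQ12 : ∀ g, nsqV M (Qk (Q₁ g) - Qk (Q₂ g)) ≤ γ * (SfV n L M R' G₂' g + nsqV M (Qk (Q₂ g))))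
    {Λ : ℝ} (hΛ : 0 ≤ Λ) (hUBf₂ : ∀ ψ : Tor M → Fin d → E, ∃ W', Qk (Q₂ W') = ψ ∧ SfV n L M R' G₂' W' ≤ Λ * nsqV M ψ)
    {w : ℝ} (hw : 0 < w) :
    ∀ (φ : Tor M → Fin d → E) (W₀ : Tor (fine n M) → Fin d → E), Qk W₀ = φ → (∀ W, Qk W = φ → ScV n M R G W₀ ≤ ScV n M R G W) →
      ∃ g, Qk (Q₂ g) = φ ∧ SfV n L M R' G₂' g
        ≤ (Real.sqrt (ScV n M R G W₀
              + (((1 + w + (1 + w⁻¹) * (Λ * γ) * (1 + 4 * γ)) * (1 + 4 * v) * (1 + u) - 1)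
                  + ((1 + w + (1 + w⁻¹) * (Λ * γ) * (1 + 4 * γ)) * (1 + 4 * v) * (1 + u)) * ε
                  + ((1 + w + (1 + w⁻¹) * (Λ * γ) * (1 + 4 * γ)) * (1 + 4 * v) * (4 * v) + 4 * ((1 + w⁻¹) * (Λ * γ))))
                * (ScV n M R G W₀ + nsqV M φ))
            + (Real.sqrt ((1 + w + (1 + w⁻¹) * (Λ * γ) * (1 + 4 * γ)) * (1 + 4 * v) * (1 + u)) * δ') * Real.sqrt (qWV n M W₀)) ^ 2 := by
  intro φ W₀ hW₀ hmin
  obtain ⟨g, hg, hF₁⟩ := hONE₁ φ W₀ hW₀ hmin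
  have hS0 : 0 ≤ ScV n M R G W₀ := ScV_nonneg n M R hG0 W₀
  have hZ0 : 0 ≤ nsqV M φ := nsqV_nonneg M _
  have hq0 : 0 ≤ qWV n M W₀ := qWV_nonneg n M W₀
  have hF₁0 : 0 ≤ SfV n L M R' G₁' g := SfV_nonneg n L M R' hG0₁ g
  have hF₂0 : 0 ≤ SfV n L M R' G₂' g := SfV_nonneg n L M R' hG0₂ g
  have hN₂0 : 0 ≤ nsqV M (Qk (Q₂ g)) := nsqV_nonneg M _
  have hwi : 0 ≤ w⁻¹ := inv_nonneg.mpr hw.le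
  -- §2 on the supplier's competitor
  obtain ⟨hN, hF₂⟩ := fine_transfer n L M hG0₁ hG0₂ hu hv0 hv hγ0 hγ hg (hG12 g) (hQ12 g)
  -- the carrier repair by the fine V-UB leaf
  obtain ⟨W', hQW', hSW'⟩ := hUBf₂ (φ - Qk (Q₂ g))
  refine ⟨g + W', by rw [hQadd₂, hQW', add_sub_cancel], ?_⟩
  have hψ : nsqV M (φ - Qk (Q₂ g)) ≤ γ * (SfV n L M R' G₂' g + nsqV M (Qk (Q₂ g))) := by rw [← hg]; exact hQ12 g
  have hY0 : 0 ≤ Λ * γ * (SfV n L M R' G₂' g + nsqV M (Qk (Q₂ g))) := by positivity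
  have hrep : SfV n L M R' G₂' W' ≤ Λ * γ * (SfV n L M R' G₂' g + nsqV M (Qk (Q₂ g))) := by
    have := mul_le_mul_of_nonneg_left hψ hΛ
    linarith [hSW', this]
  -- `SfV (g + W′) ≤ (√F₂ + √(Λγ(F₂+N₂)))² ≤ (1+w)F₂ + (1+w⁻¹)Λγ(F₂+N₂)`
  have hsum : SfV n L M R' G₂' (g + W') ≤ (1 + w) * SfV n L M R' G₂' g + (1 + w⁻¹) * (Λ * γ * (SfV n L M R' G₂' g + nsqV M (Qk (Q₂ g)))) := by
    have h1 := sqrt_SfV_add_le n L M R' hG0₂ hGadd₂ g W'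
    have h0 : 0 ≤ SfV n L M R' G₂' (g + W') := SfV_nonneg n L M R' hG0₂ _
    have h2 : Real.sqrt (SfV n L M R' G₂' W') ≤ Real.sqrt (Λ * γ * (SfV n L M R' G₂' g + nsqV M (Qk (Q₂ g)))) := Real.sqrt_le_sqrt hrep
    have h3 : Real.sqrt (SfV n L M R' G₂' (g + W'))
        ≤ Real.sqrt (SfV n L M R' G₂' g) + Real.sqrt (Λ * γ * (SfV n L M R' G₂' g + nsqV M (Qk (Q₂ g)))) := h1.trans (by linarith)
    have h4 := pow_le_pow_left₀ (Real.sqrt_nonneg _) h3 2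
    rw [Real.sq_sqrt h0] at h4
    exact h4.trans (sq_sqrt_add_sqrt_le hF₂0 hY0 hw)
  have hcol := collect_le (X := (Real.sqrt (ScV n M R G W₀ + ε * (ScV n M R G W₀ + nsqV M φ)) + δ' * Real.sqrt (qWV n M W₀)) ^ 2)
    hu hv0 hγ0 hw hΛ hN hF₂ hsum hF₁
  have hA1 : 1 ≤ (1 + w + (1 + w⁻¹) * (Λ * γ) * (1 + 4 * γ)) * (1 + 4 * v) * (1 + u) := by
    have hC1 : 1 ≤ 1 + w + (1 + w⁻¹) * (Λ * γ) * (1 + 4 * γ) := by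
      have : 0 ≤ (1 + w⁻¹) * (Λ * γ) * (1 + 4 * γ) := by positivity
      linarith
    have h1 : (1 : ℝ) ≤ 1 + 4 * v := by linarith
    have h2 : (1 : ℝ) ≤ 1 + u := by linarith
    calc (1 : ℝ) = 1 * 1 * 1 := by ring
      _ ≤ (1 + w + (1 + w⁻¹) * (Λ * γ) * (1 + 4 * γ)) * (1 + 4 * v) * (1 + u) :=
        mul_le_mul (mul_le_mul hC1 h1 zero_le_one (by linarith)) h2 zero_le_one (by positivity)
  have hB0 : 0 ≤ (1 + w + (1 + w⁻¹) * (Λ * γ) * (1 + 4 * γ)) * (1 + 4 * v) * (4 * v) + 4 * ((1 + w⁻¹) * (Λ * γ)) := by positivity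
  exact hcol.trans (shape_le hS0 hZ0 hε hδ' hA1 hB0)

end Socket

end Summit.QuantumFields.BalabanUV.T4Continuum.OneMinTransfer

end
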